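import Mathlib

/-!
# Door 4: the pairing squeeze (real-arithmetic skeleton of paper §13, Theorem 13.3 and Remark (i))

Solo line II, door 4 ("algebraic Gaussian domination": perturbative positivity with the
number-conserving Bogoliubov composite `a†_{-k} a_0 a_0`).  For the torus ground state `Ψ` and
`k ≠ 0` write `n = n_k`, `P = ⟨a_k† a†_{-k} a_0 a_0⟩`, `q = ⟨n_0 (n_0 - 1)(n_k + 1)⟩`,
`m = ⟨n_k n_0⟩`, `c = v̂(k)/V ≥ 0`, `H = v̂(0)(N-1)/V` (Hartree coefficient), `μ = E_N - E_{N-1}`.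
The exact inputs are

* perturbative positivity for `a_k`:  `ε n + W ≤ μ n`  with  `W = H n + F + c P + R`
  (Hartree + Fock + pairing + vertex remainder, an exact partition of `-⟨a_k†[V,a_k]⟩`);
* the trial-state bound `μ ≤ H`;
* `F ≥ c m` (drop the Fock terms `q ≠ k`, `v̂ ≥ 0`);
* the `2 × 2` Gram positivity of `(a_k Ψ, a†_{-k}a_0a_0 Ψ)`:  `P² ≤ n q`.

`pairing_squeeze` concludes `ε n ≤ c (√(n q) - m) - R` (Theorem 13.3), and
`pairing_squeeze_of_concentration` gives the Bogoliubov reading: if `n_0` is concentrated at `N₀`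
(`q ≤ N₀² (n+1)`, `m ≥ N₀ n`) then `ε n ≤ c N₀ / 2 - R`, i.e. the infrared bound
`n_k ≤ (½ ρ₀ v̂(k) + η_k)/ε_k` once `R ≥ -η_k` — the typed wall (VD) of §13.3.
No analysis and no second quantisation enter; this file certifies only the bookkeeping.
-/

namespace Summit.AtomisticToContinuum.BoseEinsteinCondensation.Theorems

/-- `√(n(n+1)) ≤ n + 1/2` for `n ≥ 0`. -/
theorem sqrt_mul_add_one_le (n : ℝ) (hn : 0 ≤ n) : Real.sqrt (n * (n + 1)) ≤ n + 1 / 2 := by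
  have h1 : n * (n + 1) ≤ (n + 1 / 2) ^ 2 := by nlinarith
  have h2 : 0 ≤ n + 1 / 2 := by linarith
  calc Real.sqrt (n * (n + 1)) ≤ Real.sqrt ((n + 1 / 2) ^ 2) := Real.sqrt_le_sqrt h1
    _ = n + 1 / 2 := by rw [Real.sqrt_sq h2]

/-- **Theorem 13.3 (pairing squeeze), real-arithmetic skeleton.**  Perturbative positivity for
`a_k`, the Hartree cancellation `μ ≤ H`, the Fock lower bound `c m ≤ F` and the Gram bound
`P² ≤ n q` give `ε n ≤ c (√(n q) - m) - R`. -/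
theorem pairing_squeeze (ε n W μ H F P R c m q : ℝ)
    (hPP : ε * n + W ≤ μ * n) (hW : W = H * n + F + c * P + R) (hμ : μ ≤ H) (hn : 0 ≤ n)
    (hF : c * m ≤ F) (hc : 0 ≤ c) (hP : P ^ 2 ≤ n * q) :
    ε * n ≤ c * (Real.sqrt (n * q) - m) - R := by
  have hμn : μ * n ≤ H * n := mul_le_mul_of_nonneg_right hμ hn
  -- |P| ≤ √(n q)
  have habs : |P| ≤ Real.sqrt (n * q) := by
    rw [← Real.sqrt_sq_eq_abs]
    exact Real.sqrt_le_sqrt hP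
  have hPle : -P ≤ Real.sqrt (n * q) := le_trans (neg_le_abs P) habs
  have hcP : c * (-P) ≤ c * Real.sqrt (n * q) := mul_le_mul_of_nonneg_left hPle hc
  have h0 : ε * n + F + c * P + R ≤ 0 := by
    have := hPP; rw [hW] at this; linarith
  nlinarith [h0, hcP, hF]

/-- **Remark 13.3(i) (Bogoliubov reading).**  If the zero-mode occupation is concentrated at
`N₀ ≥ 0` in the sense `q ≤ N₀² (n+1)` and `m ≥ N₀ n`, the squeeze bracket is at most `N₀/2`:
`ε n ≤ c N₀ / 2 - R`. -/
theorem pairing_squeeze_of_concentration (ε n R c m q N₀ : ℝ)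
    (hsq : ε * n ≤ c * (Real.sqrt (n * q) - m) - R) (hn : 0 ≤ n) (hc : 0 ≤ c) (hN : 0 ≤ N₀)
    (hq : q ≤ N₀ ^ 2 * (n + 1)) (hm : N₀ * n ≤ m) :
    ε * n ≤ c * N₀ / 2 - R := by
  have h1 : Real.sqrt (n * q) ≤ N₀ * Real.sqrt (n * (n + 1)) := by
    have : n * q ≤ N₀ ^ 2 * (n * (n + 1)) := by nlinarith [mul_le_mul_of_nonneg_left hq hn]
    calc Real.sqrt (n * q) ≤ Real.sqrt (N₀ ^ 2 * (n * (n + 1))) := Real.sqrt_le_sqrt this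
      _ = Real.sqrt (N₀ ^ 2) * Real.sqrt (n * (n + 1)) := Real.sqrt_mul (sq_nonneg _) _
      _ = N₀ * Real.sqrt (n * (n + 1)) := by rw [Real.sqrt_sq hN]
  have h2 : N₀ * Real.sqrt (n * (n + 1)) ≤ N₀ * (n + 1 / 2) :=
    mul_le_mul_of_nonneg_left (sqrt_mul_add_one_le n hn) hN
  have h3 : Real.sqrt (n * q) - m ≤ N₀ / 2 := by linarith
  have h4 : c * (Real.sqrt (n * q) - m) ≤ c * (N₀ / 2) := mul_le_mul_of_nonneg_left h3 hc
  linarith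

/-- **The infrared bound behind Corollary 13.4.**  With a vertex bound `R ≥ -η` and `ε > 0`:
`n ≤ (c N₀ / 2 + η) / ε`. -/
theorem occupation_le_of_pairing_squeeze (ε n R c N₀ η : ℝ)
    (h : ε * n ≤ c * N₀ / 2 - R) (hR : -η ≤ R) (hε : 0 < ε) :
    n ≤ (c * N₀ / 2 + η) / ε := by
  rw [le_div_iff₀ hε]
  linarith

end Summit.AtomisticToContinuum.BoseEinsteinCondensation.Theorems
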